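import Literature.MathematicalPhysics.QuantumFieldTheory.Balaban1983to89.B9Eq325RLipschitzClosed
import Literature.MathematicalPhysics.QuantumFieldTheory.Balaban1983to89.B9Eq365QGGQLowerVariationalSharp

/-!
# `Balaban1983to89.B9Eq325RLipschitzClosedSharp` — T. Bałaban, *Propagators for lattice gauge theories in a background field*, Commun. Math. Phys.
# **99** (1985) 389–434 [Balaban1985BackgroundPropagators] p. 403 with (3.25) p. 394, (3.35) p. 396: **THE CLOSED `‖R(U) − R(1)‖ ≤ C_R♯` ON BAŁABAN's
# DIAGONAL WITH THE SHARP FLAT FLOOR `κ₀ = (12d(6∕5)^{d−1} + a′)⁻²` AND NO `3 ≤ L`** — ne9-leaf-06's `B9Eq325RLipschitzClosed.norm_RofU_sub_RofU_one_le_of_letters`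
# (v1.2, the `κ`-minorant as a FORM slot) fed by NE9 leaf-01's `B9Eq365QGGQLowerVariationalSharp.qggq_coercive_sharp_one_diagonal` (route R2′ STEP B7′ S3, pub-balaban NE9 chain)

statement-level skeleton of published theorems with citation tags; proofs where landed; nothing here is a claim about the Yang–Mills mass gap

CITATION HEADER (lean-in-tree rule).  Audit cell `pub-balaban`, sub-cell `t4`, BINDER row NE9; OFFER O-ne9leaf01-g79-1 of NE9 formalisation-swarm
LEAF PROVER 01 (`b2b-balaban-t4-ne9-formalise-leaf-01`, gen 79) to ne9-leaf-06 (author of the closure; first refusal theirs): the one-term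
re-instantiation that the v1.2 FORM slot `hκ1` was made for (their A-5, journal l.46858, on this lineage's W-1 l.46789).  Source READ in the held
text layer (`paper:balaban1985-cmp99-background-propagators`): p. 403 *«the operators R(U), P(U) = I − R(U) … satisfy the same bounds»*, (3.25) p. 394,
(3.35) p. 396 (the diagonal `L^kη = 1`).

WHAT IS PROVED (sorry-free; 0 `def`; axioms standard; composition BY NAME).  **`norm_RofU_sub_RofU_one_le_diagonal_sharp`** — VERBATIM the statement of
ne9-leaf-06's `norm_RofU_sub_RofU_one_le_diagonal` (ηL = 1, c₀L^d = c₁, transporters `Kαη`-close to `1`, the five S3d letters as closed forms of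
`(d, a′, K, α)`, the window `0 < γ`, `0 < κ`) but with the `κ`-letter `κ = 1∕(12d(6∕5)^{d−1} + a′)² − δ_K` (`1.419·10⁻⁴ − δ_K` at d = 4, a′ = 1,
against `1.3·10⁻¹⁷ − δ_K`) and WITHOUT the hypothesis `3 ≤ L`; proof = theirs with the slot `hκ1` fed by `qggq_coercive_sharp_one_diagonal`.
HONEST SCOPE.  A re-instantiation; the `κ⁻²` structure of `C_R♯` untouched (the window `0 < κ` now reads `δ_K < 1.419·10⁻⁴` at d = 4, i.e.
`α ≲ 5·10⁻⁸` with `δ_K ≈ 2816α`, leaf-06's numbers); NOT NE9, NOT the route (NE9 NOT PRINTED ∕ NOT PROVED; spine PROVED 0∕9; finite T⁴ — NOT infinite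
volume, NOT mass gap, NOT Clay).  NEW file; imports the two named modules; nothing modified.  Net new unproved facts: 0.
-/

noncomputable section

open scoped InnerProductSpace ComplexConjugate BigOperators

namespace Literature.MathematicalPhysics.QuantumFieldTheory.Balaban1983to89.B9Eq325RLipschitzClosedSharp

open B4Sect5Torus (TSite)
open B9SectCLatticeCarrier (Bond)
open B9Eq319QprimeTorus (fineP)
open B11Eq103H1Complex (SiteL2K)
open B9Eq310HessianOperator (adTransportW)
open B9Eq326OperatorAssembly (RofU)
open B9Eq325RLipschitzClosed (norm_RofU_sub_RofU_one_le_of_letters rho_le_exp_sub_one)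
open B9Eq365QGGQLowerVariationalSharp (qggq_coercive_sharp_one_diagonal)

variable {d : ℕ} (L : ℕ) [NeZero L] (m : Fin d → ℕ) [∀ i, NeZero (fineP L m i)]
  {𝔸 : Type*} [Ring 𝔸] [Algebra ℂ 𝔸]
  {W : Type*} [NormedAddCommGroup W] [InnerProductSpace ℂ W] [FiniteDimensional ℂ W] (φ : W ≃ₗ[ℂ] 𝔸)
  (c₀ : ℝ) [Fact (0 < c₀)] (η : ℝ) (c₁ : ℝ) [Fact (0 < c₁)] {a' : ℝ} (ha' : 0 < a')
  (U : Bond d (fineP L m) → 𝔸ˣ)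
  (hRS : ∀ (b : Bond d (fineP L m)) (v u : W), ⟪adTransportW φ U b v, u⟫_ℂ = ⟪v, adTransportW φ (fun b => (U b)⁻¹) b u⟫_ℂ)
  {K α : ℝ} (hK : 0 ≤ K) (hα : 0 ≤ α) (hRε : ∀ (b : Bond d (fineP L m)) (w : W), ‖adTransportW φ U b w - w‖ ≤ K * α * η * ‖w‖)

include ha' hRS hK hα hRε

/-- **THE CLOSURE ON BAŁABAN's DIAGONAL WITH THE SHARP FLAT FLOOR**: ne9-leaf-06's `norm_RofU_sub_RofU_one_le_diagonal` with the `κ`-letter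
`κ = 1∕(12d(6∕5)^{d−1} + a′)² − δ_K` and without `3 ≤ L` — the v1.2 FORM slot `hκ1` of `norm_RofU_sub_RofU_one_le_of_letters` fed by
`qggq_coercive_sharp_one_diagonal` in one term; `t = Kα`, `ρ = e^{dKα} − 1`, `s = 1` as there. [cite: Balaban1985BackgroundPropagators, p.403, (3.25) p.394, (3.35) p.396, (3.63)–(3.68) pp.402–403, Thm 3.11 p.416] -/
theorem norm_RofU_sub_RofU_one_le_diagonal_sharp (hηL : η * L = 1) (hw : c₀ * (L : ℝ) ^ d = c₁) {γ MQ θQ θG δK κ : ℝ}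
    (hγdef : γ = 1 / (2 + 2 / a') - (Real.sqrt d * (K * α) + (Real.sqrt d * (K * α)) ^ 2 +
      a' * (Real.exp (d * K * α) - 1) * (2 + (Real.exp (d * K * α) - 1))))
    (hMQdef : MQ = Real.exp (d * K * α)) (hθQdef : θQ = Real.exp (d * K * α) - 1)
    (hθGdef : θG = 2 * (Real.sqrt d * (K * α)) * (γ⁻¹ * (Real.sqrt γ)⁻¹) + (|a'| * θQ * (MQ + MQ)) * γ⁻¹ ^ 2)
    (hδKdef : δK = MQ * (γ⁻¹ * (γ⁻¹ * θQ + θG * MQ) + θG * (γ⁻¹ * MQ)) + θQ * (γ⁻¹ * (γ⁻¹ * MQ)))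
    (hκdef : κ = 1 / (12 * (d : ℝ) * (6 / 5) ^ (d - 1) + a') ^ 2 - δK) (hγ : 0 < γ) (hκ : 0 < κ)
    (f : SiteL2K ℂ d (fineP L m) c₀ W) :
    ‖RofU L m φ η U (c₀ := c₀) f - RofU L m φ η (fun _ : Bond d (fineP L m) => (1 : 𝔸ˣ)) (c₀ := c₀) f‖ ≤
      (γ⁻¹ * (MQ * (κ⁻¹ * (MQ * θG + θQ * γ⁻¹) + κ⁻¹ * δK * κ⁻¹ * (MQ * γ⁻¹)) + θQ * (κ⁻¹ * (MQ * γ⁻¹))) +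
        θG * (MQ * (κ⁻¹ * (MQ * γ⁻¹)))) * ‖f‖ := by
  have hLr : (0 : ℝ) < L := by exact_mod_cast Nat.pos_of_ne_zero (NeZero.ne L)
  have hηL0 : 0 < η * L := by rw [hηL]; exact one_pos
  have hη0 : 0 < η := pos_of_mul_pos_left hηL0 hLr.le
  have hs : c₁ * (η * L) ^ 2 = c₀ * (L : ℝ) ^ d := by rw [hηL, one_pow, mul_one, hw]
  have hone : (η * L)⁻¹ = 1 := by rw [hηL, inv_one]
  have ht : ‖((η : ℂ))⁻¹‖ * (K * α * η) ≤ K * α := by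
    rw [norm_inv, Complex.norm_real, Real.norm_eq_abs, abs_of_pos hη0]
    rw [show η⁻¹ * (K * α * η) = K * α * (η⁻¹ * η) by ring, inv_mul_cancel₀ hη0.ne', mul_one]
  have hρ := rho_le_exp_sub_one (d := d) hK hα hηL
  refine norm_RofU_sub_RofU_one_le_of_letters L m φ c₀ η c₁ ha' U hRS (by positivity : 0 ≤ K * α * η) hRε hη0.ne' hηL0 (le_of_eq hηL) hs
    ht hρ (fun ψ => qggq_coercive_sharp_one_diagonal L m φ c₀ η c₁ hη0.ne' hηL hw ha' ψ)
    ?_ ?_ ?_ hθGdef hδKdef hκdef hγ hκ f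
  · rw [hγdef, hone]; ring
  · rw [hMQdef, hone]; ring
  · rw [hθQdef, hone, mul_one]

end Literature.MathematicalPhysics.QuantumFieldTheory.Balaban1983to89.B9Eq325RLipschitzClosedSharp

end
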